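import Mathlib.FieldTheory.IntermediateField.Adjoin.Basic
import Mathlib.FieldTheory.AlgebraicClosure
import Mathlib.Analysis.SpecialFunctions.Complex.Log
import Mathlib.RingTheory.RootsOfUnity.Complex
import Mathlib.RingTheory.RootsOfUnity.Minpoly
import HarnessLib

/-!
# The exp-closure of a subfield of `ℂ` (kernel-free towers of exponentials) and its levels

For an intermediate field `F` of `ℂ/ℚ` we define

* `Literature.NumberTheory.Transcendental.expClosure F : IntermediateField ℚ ℂ` — the smallest
  subfield of `ℂ` containing `F` and closed under `Complex.exp` (the E-subfield of `ℂ_exp`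
  generated by `F`; Kirby 2013 §2, Def. 2.1 and the notation `⟨F, a⟩^E` of §8; van den Dries 1984
  §1 "E-subring generated"; Macintyre 1991 "the smallest E-subring");
* `Literature.NumberTheory.Transcendental.expClosureLevel F k` — the LEVELS of the tower
  `E₀ = F`, `E_{k+1} = ℚ(E_k ∪ exp(E_k))`, the image-in-`ℂ` analogue of Kirby's chain
  `F ⊂ F^e ⊂ F^{ee} ⊂ ⋯` (Kirby 2013, Constructions 2.6–2.7), whose union is `F^E`;

and prove the closure algebra: `F ≤ expClosure F`, `exp` maps `expClosure F` into itself,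
minimality, monotonicity of levels, `expClosure F = ⨆ k, expClosureLevel F k`
(`expClosure_eq_iSup`), the membership form `mem_expClosure_iff` (every element lies in some
finite level) and an induction principle `expClosure_induction`; plus the corollaries used over
`F = ℚ̄ = algebraicClosure ℚ ℂ` (algebraic numbers, `I`, roots of unity `exp (2πi/n)` lie in the
tower).

## Why (route `Summits/Schanuel/Schanuel/Theses/CyclotomicRigidity`)

Ten statements of that route (GalExtTower, LogFreeTower, TowerSchanuel, TowerStrong, PiNotInTower,
GalExtImpliesRationalTowerHL, LevelOneGalExt, SchanuelImpliesLocalisation,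
TowerSchanuelImpliesGalExt, Assembly) speak about the KERNEL-FREE TOWER
`E = sInf {K : IntermediateField ℚ ℂ | algebraicClosure ℚ ℂ ≤ K ∧ ∀ w ∈ K, Complex.exp w ∈ K}`
inlined as a term, and their informal proofs run by induction on the levels `E_k`. With the
definitions below

* `expClosure (algebraicClosure ℚ ℂ)` is that inlined term **by `rfl`**
  (`expClosure_algebraicClosure_eq`), so a prover may `change`/`show` a route statement into the
  named form and use the API;
* `expClosure ⊥ = sInf {K | ∀ w ∈ K, cexp w ∈ K}` is the RATIONAL tower of
  `GalExtImpliesRationalTowerHL` (`expClosure_bot_eq`);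
* `expClosureLevel (algebraicClosure ℚ ℂ) 1` is, by `rfl`, the Lindemann–Weierstrass field
  `ℚ(ℚ̄ ∪ exp ℚ̄)` of `LevelOneGalExt` (`expClosureLevel_algebraicClosure_one`).

## Mathlib / tree search

Mathlib: `IntermediateField` is a complete lattice (`sInf`, `iSup`), `IntermediateField.adjoin`,
`IntermediateField.coe_iSup_of_directed`, `algebraicClosure`, `mem_algebraicClosure_iff`,
`Complex.isPrimitiveRoot_exp`, `IsPrimitiveRoot.isIntegral`; no exponential closure of a subfield
(`exp_closed` exists only for `CategoryTheory.ExponentialIdeal`). Tree: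
`Literature.ModelTheory.ExponentialFields.ExponentialField` has abstract E-rings, E-ring morphisms
and `expKernel` but no generated E-subfield; `Literature.NumberTheory.Transcendental.Ecl*` is the
exponential-ALGEBRAIC closure `ecl`, strictly bigger (`πi ∈ ecl ∅`), not this notion.

## Design choices

* Phrased inside Mathlib's lattice `IntermediateField ℚ ℂ` (not for an abstract
  `ExponentialRing`) precisely so that the route's inlined terms match definitionally; the set
  `{K | F ≤ K ∧ exp-closed}` contains `⊤`, so the `sInf` is a genuine closure (`le_expClosure`,
  `exp_mem_expClosure`, `expClosure_le`).
* Levels are `ℚ`-adjoins of `E_k ∪ exp '' E_k` (so `E_k ≤ E_{k+1}` and `exp E_k ⊆ E_{k+1}` are both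
  `subset_adjoin`); over `F = ℚ̄` one has `E_{k+1} = E_k(e^w : w ∈ E_k)` as in the informal texts.
* Deliberately NOT here: freeness / genericity of the levels (that is Schanuel on the tower, an open
  statement of the route), automorphism extension, countability.

## References

* J. Kirby, *Finitely presented exponential fields*, Algebra & Number Theory 7 (2013) 943–980
  = arXiv:0912.4019: Def. 2.1 (partial E-subfield generated by `X`), Constructions 2.6–2.7
  (`F^e`, `F^E = ⋃` of the chain), §8 (`⟨F,a⟩^E`, the E-subfield generated).
* L. van den Dries, *Exponential rings, exponential polynomials and exponential functions*,
  Pacific J. Math. 113 (1984), §1.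
* A. Macintyre, *Schanuel's conjecture and free exponential rings*, Ann. Pure Appl. Logic 51 (1991)
  241–246 (Schanuel's conjecture on the smallest E-subring of `ℝ` ⟺ it is free).
-/

noncomputable section

open Complex

namespace Literature.NumberTheory.Transcendental

/-- The **exp-closure** of an intermediate field `F ≤ ℂ`: the smallest subfield of `ℂ` containing
`F` and closed under the complex exponential — the E-subfield of `ℂ_exp` generated by `F`
(for `F = ℚ̄`: the *kernel-free tower* `ℚ̄ ⊂ ℚ̄(e^ℚ̄) ⊂ ⋯` of route Schanuel/CyclotomicRigidity,
see `expClosure_algebraicClosure_eq`); Kirby 2013 Def. 2.1 (generated partial E-subfield) and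
§8 (the E-subfield `⟨F;a⟩^E` generated, with iterated exponentials). [cite: Kirby2013FPEF, Def 2.1] -/
def expClosure (F : IntermediateField ℚ ℂ) : IntermediateField ℚ ℂ :=
  sInf {K : IntermediateField ℚ ℂ | F ≤ K ∧ ∀ w ∈ K, Complex.exp w ∈ K}

/-- The **levels** of the exp-closure tower over `F`: `E₀ = F` and
`E_{k+1} = ℚ(E_k ∪ exp(E_k))` — the images in `ℂ` of Kirby's chain `F ⊂ F^e ⊂ F^{ee} ⊂ ⋯`
(free only under Schanuel-type hypotheses; here just subfields of `ℂ`).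
[cite: Kirby2013FPEF, Construction 2.7] -/
def expClosureLevel (F : IntermediateField ℚ ℂ) : ℕ → IntermediateField ℚ ℂ
  | 0 => F
  | k + 1 => IntermediateField.adjoin ℚ
      ((expClosureLevel F k : Set ℂ) ∪ Complex.exp '' (expClosureLevel F k : Set ℂ))

variable (F : IntermediateField ℚ ℂ)

/-! ### The closure algebra of `expClosure` -/

/-- `F ≤ expClosure F`. [folklore] -/
theorem le_expClosure : F ≤ expClosure F :=
  le_sInf fun _ hK => hK.1

/-- Minimality: any exp-closed intermediate field containing `F` contains `expClosure F`.
[folklore] -/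
theorem expClosure_le {F K : IntermediateField ℚ ℂ} (hFK : F ≤ K)
    (hK : ∀ w ∈ K, Complex.exp w ∈ K) : expClosure F ≤ K :=
  sInf_le ⟨hFK, hK⟩

/-- `expClosure F` is closed under `Complex.exp`. [folklore] -/
theorem exp_mem_expClosure {F : IntermediateField ℚ ℂ} {w : ℂ} (hw : w ∈ expClosure F) :
    Complex.exp w ∈ expClosure F := by
  simp only [expClosure, IntermediateField.mem_sInf] at hw ⊢
  rintro K ⟨hFK, hK⟩
  exact hK w (hw K ⟨hFK, hK⟩)

/-- `expClosure` is monotone in `F`. [folklore] -/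
theorem expClosure_mono {F F' : IntermediateField ℚ ℂ} (h : F ≤ F') :
    expClosure F ≤ expClosure F' :=
  expClosure_le (h.trans (le_expClosure F')) fun _ hw => exp_mem_expClosure hw

/-- `expClosure` is idempotent. [folklore] -/
theorem expClosure_expClosure : expClosure (expClosure F) = expClosure F :=
  le_antisymm (expClosure_le le_rfl fun _ hw => exp_mem_expClosure hw)
    (le_expClosure (expClosure F))

/-! ### Levels -/

/-- `E₀ = F`. [folklore] -/
@[simp] theorem expClosureLevel_zero : expClosureLevel F 0 = F := rfl

/-- `E_{k+1} = ℚ(E_k ∪ exp(E_k))`. [folklore] -/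
theorem expClosureLevel_succ (k : ℕ) :
    expClosureLevel F (k + 1) = IntermediateField.adjoin ℚ
      ((expClosureLevel F k : Set ℂ) ∪ Complex.exp '' (expClosureLevel F k : Set ℂ)) := rfl

/-- `E_k ≤ E_{k+1}`. [folklore] -/
theorem expClosureLevel_le_succ (k : ℕ) : expClosureLevel F k ≤ expClosureLevel F (k + 1) :=
  fun _ hx => IntermediateField.subset_adjoin ℚ _ (Or.inl hx)

/-- The levels increase. [folklore] -/
theorem expClosureLevel_mono : Monotone (expClosureLevel F) :=
  monotone_nat_of_le_succ (expClosureLevel_le_succ F)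

/-- `exp(E_k) ⊆ E_{k+1}`. [folklore] -/
theorem exp_mem_expClosureLevel_succ {F : IntermediateField ℚ ℂ} {k : ℕ} {w : ℂ}
    (hw : w ∈ expClosureLevel F k) : Complex.exp w ∈ expClosureLevel F (k + 1) :=
  IntermediateField.subset_adjoin ℚ _ (Or.inr ⟨w, hw, rfl⟩)

/-- Every level lies in the exp-closure. [folklore] -/
theorem expClosureLevel_le_expClosure (k : ℕ) : expClosureLevel F k ≤ expClosure F := by
  induction k with
  | zero => exact le_expClosure F
  | succ k ih =>
    rw [expClosureLevel_succ]
    refine IntermediateField.adjoin_le_iff.mpr ?_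
    rintro x (hx | ⟨w, hw, rfl⟩)
    · exact ih hx
    · exact exp_mem_expClosure (ih hw)

/-- Membership in the union of the levels (a directed union of subfields). [folklore] -/
theorem mem_iSup_expClosureLevel_iff {x : ℂ} :
    x ∈ ⨆ k, expClosureLevel F k ↔ ∃ k, x ∈ expClosureLevel F k := by
  have hdir : Directed (· ≤ ·) (expClosureLevel F) := (expClosureLevel_mono F).directed_le
  rw [← SetLike.mem_coe, IntermediateField.coe_iSup_of_directed hdir, Set.mem_iUnion]
  simp only [SetLike.mem_coe]

/-- The union of the levels is closed under `exp`. [folklore] -/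
theorem exp_mem_iSup_expClosureLevel {x : ℂ} (hx : x ∈ ⨆ k, expClosureLevel F k) :
    Complex.exp x ∈ ⨆ k, expClosureLevel F k := by
  obtain ⟨k, hk⟩ := (mem_iSup_expClosureLevel_iff F).1 hx
  exact (mem_iSup_expClosureLevel_iff F).2 ⟨k + 1, exp_mem_expClosureLevel_succ hk⟩

/-- **The exp-closure is the union of its levels**: `expClosure F = ⨆ k, E_k`
(Kirby 2013, Construction 2.7: `F^E` is the union of the chain). [cite: Kirby2013FPEF, Construction 2.7] -/
theorem expClosure_eq_iSup : expClosure F = ⨆ k, expClosureLevel F k :=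
  le_antisymm
    (expClosure_le (le_iSup_of_le 0 le_rfl) fun _ hw => exp_mem_iSup_expClosureLevel F hw)
    (iSup_le (expClosureLevel_le_expClosure F))

/-- Every element of the exp-closure lies in some finite level. [folklore] -/
theorem mem_expClosure_iff {x : ℂ} : x ∈ expClosure F ↔ ∃ k, x ∈ expClosureLevel F k := by
  rw [expClosure_eq_iSup, mem_iSup_expClosureLevel_iff]

/-- **Induction principle** for the exp-closure: a predicate true on `F` and preserved by
`+`, `*`, `⁻¹` and `exp` holds on `expClosure F`. [folklore] -/
theorem expClosure_induction {F : IntermediateField ℚ ℂ} {p : ℂ → Prop} (hF : ∀ x ∈ F, p x)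
    (hadd : ∀ x y, p x → p y → p (x + y)) (hmul : ∀ x y, p x → p y → p (x * y))
    (hinv : ∀ x, p x → p x⁻¹) (hexp : ∀ x, p x → p (Complex.exp x)) {x : ℂ}
    (hx : x ∈ expClosure F) : p x := by
  let K : IntermediateField ℚ ℂ :=
    { carrier := {x | p x}
      mul_mem' := fun {a b} ha hb => hmul a b ha hb
      one_mem' := hF 1 (one_mem F)
      add_mem' := fun {a b} ha hb => hadd a b ha hb
      zero_mem' := hF 0 (zero_mem F)
      algebraMap_mem' := fun q => hF _ (algebraMap_mem F q)
      inv_mem' := fun x hx => hinv x hx }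
  exact expClosure_le (K := K) (fun x hx => hF x hx) (fun w hw => hexp w hw) hx

/-- A field `ℚ(z, e^z)` generated by a tuple FROM the exp-closure stays inside it (the shape of
the fields in Schanuel-type statements on the tower). [folklore] -/
theorem adjoin_exp_le_expClosure {F : IntermediateField ℚ ℂ} {ι : Type*} {z : ι → ℂ}
    (hz : ∀ i, z i ∈ expClosure F) :
    IntermediateField.adjoin ℚ (Set.range z ∪ Set.range (Complex.exp ∘ z)) ≤ expClosure F := by
  refine IntermediateField.adjoin_le_iff.mpr ?_
  rintro x (⟨i, rfl⟩ | ⟨i, rfl⟩)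
  · exact hz i
  · exact exp_mem_expClosure (hz i)

/-! ### The two towers of route Schanuel/CyclotomicRigidity -/

/-- The route's inlined KERNEL-FREE TOWER over `ℚ̄` is `expClosure (algebraicClosure ℚ ℂ)`,
definitionally. [folklore] -/
theorem expClosure_algebraicClosure_eq :
    expClosure (algebraicClosure ℚ ℂ) =
      sInf {K : IntermediateField ℚ ℂ | algebraicClosure ℚ ℂ ≤ K ∧ ∀ w ∈ K, Complex.exp w ∈ K} :=
  rfl

/-- The route's RATIONAL tower (smallest exp-closed subfield of `ℂ`) is `expClosure ⊥`.
[folklore] -/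
theorem expClosure_bot_eq :
    expClosure ⊥ = sInf {K : IntermediateField ℚ ℂ | ∀ w ∈ K, Complex.exp w ∈ K} := by
  simp [expClosure]

/-- Level one over `ℚ̄` is the Lindemann–Weierstrass field `ℚ(ℚ̄ ∪ e^{ℚ̄})`, definitionally.
[folklore] -/
theorem expClosureLevel_algebraicClosure_one :
    expClosureLevel (algebraicClosure ℚ ℂ) 1 =
      IntermediateField.adjoin ℚ ((algebraicClosure ℚ ℂ : Set ℂ) ∪
        Complex.exp '' (algebraicClosure ℚ ℂ : Set ℂ)) := rfl

/-- The rational tower sits inside the tower over any `F`. [folklore] -/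
theorem expClosure_bot_le : expClosure ⊥ ≤ expClosure F :=
  expClosure_mono bot_le

/-- Algebraic numbers lie in the tower over `ℚ̄`. [folklore] -/
theorem mem_expClosure_of_isAlgebraic {x : ℂ} (hx : IsAlgebraic ℚ x) :
    x ∈ expClosure (algebraicClosure ℚ ℂ) :=
  le_expClosure _ (mem_algebraicClosure_iff.2 hx)

/-- `i` lies in the tower over `ℚ̄`. [folklore] -/
theorem I_mem_expClosure : I ∈ expClosure (algebraicClosure ℚ ℂ) := by
  refine mem_expClosure_of_isAlgebraic ⟨Polynomial.X ^ 2 + Polynomial.C 1,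
    Polynomial.X_pow_add_C_ne_zero (by norm_num) 1, ?_⟩
  simp [Complex.I_sq]

/-- `e = exp 1` lies in every exp-closure. [folklore] -/
theorem exp_one_mem_expClosure : Complex.exp 1 ∈ expClosure F :=
  exp_mem_expClosure (one_mem _)

/-- Roots of unity `exp (2πi/n)` lie in the tower over `ℚ̄` (they are algebraic). [folklore] -/
theorem exp_two_pi_I_div_mem_expClosure (n : ℕ) (hn : n ≠ 0) :
    Complex.exp (2 * Real.pi * I / n) ∈ expClosure (algebraicClosure ℚ ℂ) := by
  refine mem_expClosure_of_isAlgebraic ?_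
  have hprim := Complex.isPrimitiveRoot_exp n hn
  have hint : IsIntegral ℤ (Complex.exp (2 * Real.pi * I / n)) :=
    hprim.isIntegral (Nat.pos_of_ne_zero hn)
  exact (hint.tower_top (A := ℚ)).isAlgebraic

end Literature.NumberTheory.Transcendental
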